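import Summits.Schanuel.Schanuel.Theorems.RootDecomp1KLogLogCell01

/-!
# RootDecomp1KLogLogCell — lens 1, generation 35 «LOG-LOG CELL of 33364» (RootDecomp1KLogLogCell.lean 05ce2a21…, 1940 l) — continuation (RootDecomp1KLogLogCell02): §3 EXTRACTION at the log·loglog scale: `LogLogMeasure θ` + `LogLogLiouville ρ` ⇒ `(ρ, θ)` free

(lens-1 g35 `RootDecomp1KLogLogCell.lean`, sha256 05ce2a21…c847, own farm rc 0 · 0 sorry · axioms std; critic VERDICT STATUS L1698 PORT GO LOW;
port by census-1 gen 15 in eight parts `RootDecomp1KLogLogCell01`–`08` — see the PORT NOTE of part 01; `--supports stmt-Schanuel-33364`; rung 0.)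
-/

noncomputable section

open Complex IntermediateField Polynomial
open Summit.Schanuel.Schanuel.Theorems.RootDecomp1KHyper
open Summit.Schanuel.Schanuel.Theorems.RootDecomp1KHyper.HyperCell
open Summit.Schanuel.Schanuel.Theorems.RootDecomp1KGeneric
open Summit.Schanuel.Schanuel.Theorems.RootDecomp1KRelLiouvilleCell

namespace Summit.Schanuel.Schanuel.Theorems.RootDecomp1KLogLogCell

/-- `1 ≤ 1 + log L` and `1 ≤ 1 + log (1 + log L)` for `L ≥ 1`. -/
private theorem one_le_loglog {L : ℝ} (hL : 1 ≤ L) :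
    1 ≤ 1 + Real.log L ∧ 1 ≤ 1 + Real.log (1 + Real.log L) := by
  have h1 : 0 ≤ Real.log L := Real.log_nonneg hL
  exact ⟨by linarith, by linarith [Real.log_nonneg (show (1 : ℝ) ≤ 1 + Real.log L by linarith)]⟩

/-- `4 log 2 ≥ e`, i.e. `log 16 ≥ exp 1`: so `log log q ≥ 1` once `q ≥ 16`. -/
private theorem one_le_log_log_of_sixteen_le {x : ℝ} (hx : 16 ≤ x) : 1 ≤ Real.log (Real.log x) := by
  have h2 := Real.log_two_gt_d9
  have he := Real.exp_one_lt_d9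
  have h16 : Real.log 16 = 4 * Real.log 2 := by
    rw [show (16 : ℝ) = 2 ^ 4 by norm_num, Real.log_pow]; norm_num
  have hlog16 : Real.exp 1 ≤ Real.log x := by
    refine le_trans ?_ (Real.log_le_log (by norm_num) hx)
    rw [h16]; linarith
  rw [← Real.log_exp 1]
  exact Real.log_le_log (Real.exp_pos 1) hlog16

/-- `1 ≤ log q` for `q ≥ 16` (crude). -/
private theorem one_le_log_of_sixteen_le {x : ℝ} (hx : 16 ≤ x) : 1 ≤ Real.log x := by
  rw [← Real.log_exp 1]
  refine Real.log_le_log (Real.exp_pos 1) (le_trans ?_ hx)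
  have := Real.exp_one_lt_d9; linarith

/-! ## §3  EXTRACTION at the log·loglog scale: `LogLogMeasure θ` + `LogLogLiouville ρ` ⇒ `(ρ, θ)` free

(g34 §3 / Hyper18 §17k with the two classes swapped: the measure of `θ` at the cleared specialisation
`H = q^K P(p/q, X⃗)` costs `exp(−C·c₁t·(2 + log c₁)s)` (`t = log q`, `s = log t ≥ 1` once `q ≥ 16`), the
approximation pays `exp(−m·t·s)`, and `m` — quantified in the class — absorbs every constant.) -/

/-- **Log-log extraction in several variables (kernel).** No relation `Σ_{k ≤ K} G_k(θ) ρ^k = 0`,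
`G_k ∈ ℤ[X₁, …, Xₙ]` not all zero, between a tuple `θ` with a `LogLogMeasure` and a log-log-Liouville `ρ`. -/
theorem no_int_relation_of_logLogMeasure_logLogLiouville {n : ℕ} {θ : Fin n → ℂ}
    (hθ : LogLogMeasure θ) {ρ : ℝ} (hρ : LogLogLiouville ρ) {K : ℕ}
    (G : Fin (K + 1) → MvPolynomial (Fin n) ℤ) (hG : ∃ k, G k ≠ 0)
    (hrel : ∑ k : Fin (K + 1), MvPolynomial.aeval θ (G k) * (ρ : ℂ) ^ (k : ℕ) = 0) : False := by
  -- the complex polynomial μ(Y) = Σ_k G_k(θ) Y^k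
  set μ : ℂ[X] := ∑ k : Fin (K + 1), C (MvPolynomial.aeval θ (G k)) * X ^ (k : ℕ) with hμdef
  have hμeval : ∀ y : ℂ, μ.eval y =
      ∑ k : Fin (K + 1), MvPolynomial.aeval θ (G k) * y ^ (k : ℕ) := by
    intro y
    simp only [hμdef, eval_finsetSum, eval_mul, eval_C, eval_pow, eval_X]
  have hμcoeff : ∀ k : Fin (K + 1), μ.coeff k = MvPolynomial.aeval θ (G k) := by
    intro k
    simp only [hμdef, finsetSum_coeff, coeff_C_mul, coeff_X_pow]
    rw [Finset.sum_eq_single k]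
    · simp
    · intro j _ hjk
      have : (k : ℕ) ≠ (j : ℕ) := fun h => hjk (Fin.ext h).symm
      simp [this]
    · intro h; exact absurd (Finset.mem_univ k) h
  have hμ0 : μ ≠ 0 := by
    obtain ⟨k, hk⟩ := hG
    intro h0
    have h1 : μ.coeff k = 0 := by rw [h0, coeff_zero]
    rw [hμcoeff] at h1
    exact mvaeval_ne_zero_of_logLogMeasure hθ hk h1
  have hroot : μ.eval (ρ : ℂ) = 0 := by rw [hμeval]; exact hrel
  obtain ⟨δ, hδ, hδroot⟩ := exists_ball_eval_ne_zero μ hμ0 ρ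
  obtain ⟨M, hM, hLip⟩ := exists_lipschitz_at_root μ ρ hroot
  -- sizes
  set D : ℕ := Finset.univ.sup fun k : Fin (K + 1) => (G k).totalDegree with hDdef
  have hD : ∀ k, (G k).totalDegree ≤ D := fun k =>
    Finset.le_sup (f := fun k : Fin (K + 1) => (G k).totalDegree) (Finset.mem_univ k)
  obtain ⟨Cm, hCm, hmeas⟩ := hθ D
  set Λ : ℤ := ∑ k : Fin (K + 1), mvlen (G k) with hΛ
  have hΛ0 : 0 ≤ Λ := Finset.sum_nonneg fun _ _ => mvlen_nonneg _
  set A : ℕ := ⌈|ρ|⌉₊ + 2 with hA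
  set Cq : ℕ := Λ.toNat * A ^ K + 3 with hCq
  have hCq3 : (3 : ℝ) ≤ Cq := by
    rw [hCq]; push_cast; linarith [show (0:ℝ) ≤ (Λ.toNat : ℝ) * (A : ℝ) ^ K by positivity]
  set c₁ : ℝ := 1 + Real.log Cq + K with hc₁
  have hlogCq : 0 ≤ Real.log Cq := Real.log_nonneg (by linarith)
  have hc₁1 : 1 ≤ c₁ := by rw [hc₁]; linarith [show (0 : ℝ) ≤ K from Nat.cast_nonneg K]
  have hlogc₁ : 0 ≤ Real.log c₁ := Real.log_nonneg hc₁1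
  -- the constant of the lower bound `exp(−c₂ · t · s)` and the class parameter `m`
  set c₂ : ℝ := Cm * c₁ * (2 + Real.log c₁) with hc₂
  have hc₂0 : 0 ≤ c₂ := by positivity
  set m : ℕ := ⌈c₂⌉₊ + K + ⌈M⌉₊ + 1 with hm
  have hmR : c₂ + K + M + 1 ≤ (m : ℝ) := by
    rw [hm]; push_cast; linarith [Nat.le_ceil c₂, Nat.le_ceil M]
  -- a log-log approximation with a large denominator
  obtain ⟨r, hden, hne, hlt⟩ := hρ (max m (⌈δ⁻¹⌉₊ + 16))
  set q : ℕ := r.den with hq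
  set p : ℤ := r.num with hp
  have hden' : ⌈δ⁻¹⌉₊ + 16 ≤ q := (le_max_right _ _).trans hden
  have hdenm : m ≤ q := (le_max_left _ _).trans hden
  have hdenR : ((⌈δ⁻¹⌉₊ : ℕ) : ℝ) + 16 ≤ q := by exact_mod_cast hden'
  have hmq : (m : ℝ) ≤ q := by exact_mod_cast hdenm
  have hceilδ : δ⁻¹ ≤ ⌈δ⁻¹⌉₊ := Nat.le_ceil _
  have hδinv : 0 < δ⁻¹ := inv_pos.mpr hδ
  have hq16 : (16 : ℝ) ≤ q := by linarith
  have hq1 : (1 : ℝ) < q := by linarith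
  have hqpos : (0 : ℝ) < q := by linarith
  have hq0 : q ≠ 0 := by rintro h; rw [h] at hqpos; simp at hqpos
  have hqinvδ : (q : ℝ)⁻¹ < δ := by
    have h1 : δ⁻¹ < q := by linarith
    exact (inv_lt_comm₀ hδ hqpos).mp h1
  set t : ℝ := Real.log q with ht
  have ht1 : 1 ≤ t := one_le_log_of_sixteen_le hq16
  have ht0 : 0 < t := by linarith
  set s : ℝ := Real.log t with hs
  have hs1 : 1 ≤ s := by rw [hs, ht]; exact one_le_log_log_of_sixteen_le hq16
  have hs0 : 0 < s := by linarith
  -- x := r = p/q as a real number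
  set x : ℝ := (r : ℝ) with hx
  have hxpq : x = (p : ℝ) / q := by rw [hx, hp, hq]; exact Rat.cast_def r
  have hxρ : |x - ρ| < Real.exp (-((m : ℝ) * t * s)) := by
    rw [abs_sub_comm]
    refine hlt.trans_le (Real.exp_le_exp.mpr (neg_le_neg ?_))
    have hmax : (m : ℝ) ≤ ((max m (⌈δ⁻¹⌉₊ + 16) : ℕ) : ℝ) := by exact_mod_cast le_max_left _ _
    exact mul_le_mul_of_nonneg_right (mul_le_mul_of_nonneg_right hmax ht0.le) hs0.le
  have hm1 : (1 : ℝ) ≤ m := by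
    have : (1 : ℕ) ≤ m := by rw [hm]; omega
    exact_mod_cast this
  have hqm1 : Real.exp (-((m : ℝ) * t * s)) ≤ (q : ℝ)⁻¹ := by
    have h1 : t ≤ (m : ℝ) * t * s := by
      have h1a : t ≤ (m : ℝ) * t := le_mul_of_one_le_left ht0.le hm1
      have h1b : (m : ℝ) * t ≤ (m : ℝ) * t * s := le_mul_of_one_le_right (by positivity) hs1
      exact h1a.trans h1b
    calc Real.exp (-((m : ℝ) * t * s)) ≤ Real.exp (-t) := Real.exp_le_exp.mpr (by linarith)
      _ = (q : ℝ)⁻¹ := by rw [ht, Real.exp_neg, Real.exp_log hqpos]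
  have hxρ1 : |x - ρ| ≤ 1 := by
    have : (q : ℝ)⁻¹ ≤ 1 := inv_le_one_of_one_le₀ hq1.le
    linarith
  have hxρδ : |x - ρ| < δ := by linarith
  have hxne : x ≠ ρ := fun h => hne (by rw [← h])
  -- (1) μ(x) ≠ 0
  have hμx : μ.eval (x : ℂ) ≠ 0 := hδroot x hxne hxρδ
  -- (2) the integer polynomial H = q^K P(X, p/q) and its value at θ
  set H : MvPolynomial (Fin n) ℤ := mvspecialise G p q with hH
  have hxC : ((x : ℝ) : ℂ) = (p : ℂ) / (q : ℂ) := by rw [hxpq]; push_cast; rfl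
  have hHe : MvPolynomial.aeval θ H = (q : ℂ) ^ K * μ.eval (x : ℂ) := by
    rw [hH, mvaeval_mvspecialise G p hq0 θ, hμeval, hxC]
  have hqC : (q : ℂ) ≠ 0 := by exact_mod_cast hq0
  have hH0 : H ≠ 0 := by
    intro h0
    have : (q : ℂ) ^ K * μ.eval (x : ℂ) = 0 := by rw [← hHe, h0, map_zero]
    rcases mul_eq_zero.mp this with h | h
    · exact pow_ne_zero K hqC h
    · exact hμx h
  -- (3) upper bound
  have hup : ‖MvPolynomial.aeval θ H‖ < (q : ℝ) ^ K * M * Real.exp (-((m : ℝ) * t * s)) := by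
    rw [hHe, norm_mul, norm_pow, Complex.norm_natCast]
    calc (q : ℝ) ^ K * ‖μ.eval (x : ℂ)‖ ≤ (q : ℝ) ^ K * (M * |x - ρ|) := by
          gcongr; exact hLip x hxρ1
      _ < (q : ℝ) ^ K * (M * Real.exp (-((m : ℝ) * t * s))) := by gcongr
      _ = _ := by ring
  -- (4) the length of H
  have hdegH : H.totalDegree ≤ D := totalDegree_mvspecialise_le G p q hD
  have hpq_bound : (|p| : ℤ) + q ≤ (A : ℤ) * q := by
    have h2 : |(p : ℝ) / q| ≤ |ρ| + 1 := by
      calc |(p : ℝ) / q| = |(x - ρ) + ρ| := by rw [hxpq]; ring_nf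
        _ ≤ |x - ρ| + |ρ| := abs_add_le _ _
        _ ≤ |ρ| + 1 := by linarith
    rw [abs_div, abs_of_pos hqpos, div_le_iff₀ hqpos] at h2
    have h3 : |ρ| ≤ ⌈|ρ|⌉₊ := Nat.le_ceil _
    have h4a : (|ρ| + 1) * (q : ℝ) ≤ ((⌈|ρ|⌉₊ : ℝ) + 1) * q :=
      mul_le_mul_of_nonneg_right (by linarith) hqpos.le
    have h4 : |(p : ℝ)| + q ≤ ((⌈|ρ|⌉₊ : ℝ) + 2) * q := by linarith
    have h5 : (((|p| + q : ℤ)) : ℝ) ≤ (((A : ℤ) * q : ℤ) : ℝ) := by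
      rw [hA]; push_cast; linarith
    exact_mod_cast h5
  have hpq0 : (0 : ℤ) ≤ |p| + q := by positivity
  have hlenH : mvlen H ≤ ((Cq * q ^ K : ℕ) : ℤ) := by
    calc mvlen H ≤ (|p| + q) ^ K * Λ := mvlen_mvspecialise_le G p q
      _ ≤ ((A : ℤ) * q) ^ K * Λ := by gcongr
      _ = (A : ℤ) ^ K * (q : ℤ) ^ K * Λ := by ring
      _ ≤ (A : ℤ) ^ K * (q : ℤ) ^ K * Λ.toNat + 3 * (q : ℤ) ^ K := by
          have h1 : Λ ≤ Λ.toNat := Int.self_le_toNat Λ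
          have h2 : (0 : ℤ) ≤ (A : ℤ) ^ K * (q : ℤ) ^ K := by positivity
          have h3 : (0 : ℤ) ≤ 3 * (q : ℤ) ^ K := by positivity
          exact le_add_of_le_of_nonneg (mul_le_mul_of_nonneg_left h1 h2) h3
      _ = ((Cq * q ^ K : ℕ) : ℤ) := by rw [hCq]; push_cast; ring
  have hlenR : ((mvlen H : ℤ) : ℝ) ≤ (Cq : ℝ) * (q : ℝ) ^ K := by
    have h1 : (((mvlen H : ℤ)) : ℝ) ≤ (((Cq * q ^ K : ℕ) : ℤ) : ℝ) := by exact_mod_cast hlenH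
    have h2 : (((Cq * q ^ K : ℕ) : ℤ) : ℝ) = (Cq : ℝ) * (q : ℝ) ^ K := by push_cast; ring
    rw [← h2]; exact h1
  have hlen1 : (1 : ℝ) ≤ ((mvlen H : ℤ) : ℝ) := by exact_mod_cast one_le_mvlen hH0
  -- (5) the lower bound of the measure: `1 + log (mvlen H) ≤ c₁ t`, `1 + log(c₁ t) ≤ (2 + log c₁) s`
  have hlow : Real.exp (-(Cm * (1 + Real.log ((mvlen H : ℤ) : ℝ)) *
      (1 + Real.log (1 + Real.log ((mvlen H : ℤ) : ℝ))))) ≤ ‖MvPolynomial.aeval θ H‖ :=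
    hmeas H hH0 hdegH
  set U : ℝ := 1 + Real.log ((mvlen H : ℤ) : ℝ) with hU
  have hU1 : 1 ≤ U := (one_le_loglog hlen1).1
  have hUle : U ≤ c₁ * t := by
    have h1 : Real.log ((mvlen H : ℤ) : ℝ) ≤ Real.log ((Cq : ℝ) * (q : ℝ) ^ K) :=
      Real.log_le_log (by linarith) hlenR
    rw [Real.log_mul (by linarith) (by positivity), Real.log_pow] at h1
    rw [hU, hc₁]
    have h2 : (1 + Real.log Cq) ≤ (1 + Real.log Cq) * t := le_mul_of_one_le_right (by linarith) ht1
    rw [← ht] at h1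
    have e : (1 + Real.log ↑Cq + ↑K) * t = (1 + Real.log Cq) * t + ↑K * t := by ring
    rw [e]
    linarith
  have hVle : 1 + Real.log U ≤ (2 + Real.log c₁) * s := by
    have h1 : Real.log U ≤ Real.log (c₁ * t) := Real.log_le_log (by linarith) hUle
    rw [Real.log_mul (by linarith) ht0.ne', ← hs] at h1
    have h2 : Real.log c₁ ≤ Real.log c₁ * s := le_mul_of_one_le_right hlogc₁ hs1
    have e : (2 + Real.log c₁) * s = 2 * s + Real.log c₁ * s := by ring
    rw [e]
    linarith
  have hlow' : Real.exp (-(c₂ * t * s)) ≤ ‖MvPolynomial.aeval θ H‖ := by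
    refine le_trans (Real.exp_le_exp.mpr (neg_le_neg ?_)) hlow
    have hV0 : 0 ≤ 1 + Real.log U := by linarith [Real.log_nonneg hU1]
    calc Cm * U * (1 + Real.log U) ≤ Cm * (c₁ * t) * ((2 + Real.log c₁) * s) :=
          mul_le_mul (mul_le_mul_of_nonneg_left hUle hCm.le) hVle hV0 (by positivity)
      _ = c₂ * t * s := by rw [hc₂]; ring
  -- (6) the clash: `K t + log M − m t s ≤ −c₂ t s`
  have hchain := hlow'.trans_lt hup
  have hqK : (q : ℝ) ^ K = Real.exp (K * t) := by
    rw [ht, ← Real.log_pow, Real.exp_log (by positivity)]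
  have hMexp : M = Real.exp (Real.log M) := (Real.exp_log hM).symm
  have hts1 : 1 ≤ t * s := one_le_mul_of_one_le_of_one_le ht1 hs1
  have htts : t ≤ t * s := le_mul_of_one_le_right ht0.le hs1
  have hlogM : Real.log M ≤ M * (t * s) := by
    have h1 : Real.log M ≤ M := (Real.log_le_sub_one_of_pos hM).trans (by linarith)
    have h2 : M * 1 ≤ M * (t * s) := mul_le_mul_of_nonneg_left hts1 hM.le
    linarith
  have hfin : (q : ℝ) ^ K * M * Real.exp (-((m : ℝ) * t * s)) ≤ Real.exp (-(c₂ * t * s)) := by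
    rw [hqK, hMexp, ← Real.exp_add, ← Real.exp_add]
    refine Real.exp_le_exp.mpr ?_
    have h1 := mul_le_mul_of_nonneg_right hmR (zero_le_one.trans hts1)
    have e : (c₂ + ↑K + M + 1) * (t * s) = c₂ * (t * s) + ↑K * (t * s) + M * (t * s) + t * s := by ring
    rw [e] at h1
    have h2 : (K : ℝ) * t ≤ K * (t * s) := mul_le_mul_of_nonneg_left htts (Nat.cast_nonneg K)
    have e2 : (m : ℝ) * t * s = m * (t * s) := mul_assoc _ _ _
    have e3 : c₂ * t * s = c₂ * (t * s) := mul_assoc _ _ _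
    rw [e2, e3]
    linarith
  exact absurd hchain (not_lt.mpr hfin)

/-- **Log-log class principle in several variables (kernel).** A tuple `θ` with a `LogLogMeasure`
and a log-log-Liouville `ρ` form an algebraically independent `(n+1)`-tuple `(ρ, θ₁, …, θₙ)`. -/
theorem algebraicIndependent_option_of_logLogMeasure_logLogLiouville {n : ℕ} {θ : Fin n → ℂ}
    (hθ : LogLogMeasure θ) {ρ : ℝ} (hρ : LogLogLiouville ρ) :
    AlgebraicIndependent ℚ (fun o : Option (Fin n) => o.elim (ρ : ℂ) θ) := by
  have hθi := algebraicIndependent_of_logLogMeasure hθ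
  rw [hθi.option_iff_transcendental]
  intro halg
  obtain ⟨K, G, hGK, hrel⟩ := exists_int_mvrelation halg
  exact no_int_relation_of_logLogMeasure_logLogLiouville hθ hρ G ⟨Fin.last K, hGK⟩ hrel

/-- Schanuel's bound from it: a tuple `z : Fin (n+1) → ℂ` whose Schanuel field contains a log-log-Liouville
real and `n` numbers with a simultaneous log-log measure has `trdeg ≥ n + 1`. -/
theorem sb_of_logLogLiouville_of_logLogMeasure {n : ℕ} {z : Fin (n + 1) → ℂ}
    {ρ : ℝ} (hρ : LogLogLiouville ρ) (hρz : (ρ : ℂ) ∈ adjoin ℚ (SFset z ∪ {I}))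
    {θ : Fin n → ℂ} (hθ : LogLogMeasure θ) (hθz : ∀ j, θ j ∈ adjoin ℚ (SFset z ∪ {I})) :
    SB (n + 1) z := by
  have hai := algebraicIndependent_option_of_logLogMeasure_logLogLiouville hθ hρ
  refine sb_of_algebraicIndependent hai (by simp) fun o => ?_
  cases o with
  | none => exact hρz
  | some j => exact hθz j

end Summit.Schanuel.Schanuel.Theorems.RootDecomp1KLogLogCell
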